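import Literature.AnabelianGeometry.AbsoluteAnabelian.AbsTopIII.CcnSynchronization
import Literature.AnabelianGeometry.AbsoluteAnabelian.AbsTopIII.CuspidalSynchronization
import HarnessLib

/-!
# [AbsTopIII] Prop. 1.4 (ii) / Thm. 1.9 (b) at the level of a model: sections, the natural form of (b)

Mochizuki, *Topics in Absolute Anabelian Geometry III*, §1, Prop. 1.4 (i)(ii) pp. 31–32, Thm. 1.9 (b)
p. 37 (lit key `paper:url-5493eb38cbb7`).

Corollaries of `CcnTransgression.lean` / `CcnSynchronization.lean` for the presentations of a model
`M : CurveModel`: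

* `CurveModel.surjOn_geom_res` — under `Prop_1_4_i'` (the cuspidal quotient `Π_{U} ↠ Π_{X}` is
  surjective with bijective Galois part), `Δ_U ↠ Δ_X`; hence `CurveModel.nonempty_ccnSection_res`:
  continuous sections of `Δ^{c-cn}_{U_x} ↠ Δ_X` exist for every presentation (PROVED) — the section
  datum of the differential / synchronization is never vacuous;
* `CurveModel.inertiaSynchronization_decomp` — for a cusp `x` with `I_x ≤ N` and `d ∈ D_x`, the
  synchronization `I_x → M_X` is `D_x`-EQUIVARIANT (PROVED; `CuspidalData.conj_mem_Icusp` +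
  `inertiaSynchronization_conj`) — exactly the equivariance clause typed as data in `Thm_1_9_b`;
* `CurveModel.Thm_1_9_b_natural` — Thm. 1.9 (b) for a cyclotome presentation `(U_x ⊆ X, x)` in its
  NATURAL form: THE synchronization `inertiaSynchronization` is bijective.  NAMED FACT relative to `M`
  (the faithful reading of "one constructs the natural isomorphisms `I_z ⥲ M_Z`" for `Z ∖ U = {z}`;
  the several-cusps case of the text reduces to it through `U ⊆ Z ∖ {z} ⊆ Z` and Prop. 1.4 (i), a
  transport `CurveModel` cannot express without a third curve — recorded).

HONEST FRAMING: typed ≠ discharged; nothing here bears on [IUTchIII] Cor. 3.12.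
-/

noncomputable section

open CategoryTheory

universe u

namespace Literature.AnabelianGeometry.AbsoluteAnabelian.AbsTopIII

namespace CurveModel

variable (M : CurveModel.{u})

/-- Under Prop. 1.4 (i) (`Prop_1_4_i'`: `Π_U ↠ Π_X` surjective, `G_k → G_k` bijective) the cuspidal
quotient maps `Δ_U` ONTO `Δ_X`. [cite: MochizukiAbsTopIII2015, Prop 1.4 (i) p.31] -/
theorem surjOn_geom_res (h14 : M.Prop_1_4_i') {U X : M.Curve} (h : M.IsCofiniteOpen U X)
    (hU : M.IsScheme U) (hX : M.IsScheme X) :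
    Set.SurjOn (M.res h).arith (M.ext U).geom (M.ext X).geom := by
  obtain ⟨hsurj, hbij, -⟩ := h14 U X h hU hX
  intro g' hg'
  obtain ⟨g, rfl⟩ := hsurj g'
  refine ⟨g, ?_, rfl⟩
  change (M.ext U).aug g = 1
  have h1 : (M.ext X).aug ((M.res h).arith g) = 1 := hg'
  rw [(M.res h).comm] at h1
  exact hbij.1 (by rw [h1, map_one])

/-- Hence continuous sections of `Δ^{c-cn}_{U} ↠ Δ_X` EXIST for every presentation of the model
(under Prop. 1.4 (i)). [cite: MochizukiAbsTopIII2015, Prop 1.4 (ii) p.31] -/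
theorem nonempty_ccnSection_res (h14 : M.Prop_1_4_i') {U X : M.Curve} (h : M.IsCofiniteOpen U X)
    (hU : M.IsScheme U) (hX : M.IsScheme X) : Nonempty (CcnSection (M.res h)) :=
  nonempty_ccnSection (M.res h) (M.surjOn_geom_res h14 h hU hX)

/-- **`D_x`-equivariance of the synchronization `I_x → M_X`** for a cusp `x` with `I_x ≤ N`
(e.g. a cyclotome presentation): for `d ∈ D_x` and `i ∈ I_x`, `sync(d i d⁻¹) = d · sync(i)`.  PROVED —
the equivariance clause that `Thm_1_9_b` / `Prop_1_4_ii_sync` carry as part of an `∃`.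
[cite: MochizukiAbsTopIII2015, Thm 1.9 (b) p.37] -/
theorem inertiaSynchronization_decomp {U X : M.Curve} (h : M.IsCofiniteOpen U X)
    (x : (M.cusps U).Cusp) (hI : (M.cusps U).Icusp x ≤ cuspidalKernel (M.res h))
    (s : CcnSection (M.res h))
    (hd : Function.Bijective (ccnTransgression (M.res h) ZHatCoeff.{u} s))
    {d : (M.ext U).arith} (hdx : d ∈ (M.cusps U).Dcusp x) (i : (M.cusps U).Icusp x) :
    inertiaSynchronization (M.res h) hI s hd
        (Additive.ofMul ⟨d * i * d⁻¹, (M.cusps U).conj_mem_Icusp x hdx i.2⟩) =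
      geomCyclotomeDualMap (M.ext X) ZHatCoeff.{u} ((M.res h).arith d)
        (inertiaSynchronization (M.res h) hI s hd (Additive.ofMul i)) :=
  inertiaSynchronization_conj hI s hd d i _

/-- **Thm. 1.9 (b) in natural form, relative to `M`** ("One constructs the natural isomorphisms
`I_z ⥲ μ_Ẑ(Π_U) := M_Z` [...] via the technique of Proposition 1.4, (ii)", p. 37), for a cyclotome
presentation `(U_x ⊆ X, x)` (`Z ∖ U = {x}`): THE synchronization
`inertiaSynchronization : I_x → M_X = Hom(H²(Δ_X, Ẑ), Ẑ)` (constructed, section-independent,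
`D_x`-equivariant — all proved) is BIJECTIVE, for every section and every bijectivity witness of the
differential.  NAMED FACT relative to `M`.
-- TODO(general form): several rational cusps `z ∈ Z ∖ U` (transport along `U ⊆ Z ∖ {z} ⊆ Z`,
-- Prop. 1.4 (i)) and the intermediate cover `U ⊆ Y → X` of the text.
[cite: MochizukiAbsTopIII2015, Thm 1.9 (b) p.37] -/
def Thm_1_9_b_natural (M : CurveModel.{u}) : Prop :=
  ∀ (Ux X : M.Curve) (h : M.IsCofiniteOpen Ux X) (x : (M.cusps Ux).Cusp)
    (hp : M.IsCyclotomePresentation h x) (s : CcnSection (M.res h))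
    (hd : Function.Bijective (ccnTransgression (M.res h) ZHatCoeff.{u} s)),
      Function.Bijective
        (inertiaSynchronization (M.res h) hp.isCuspidallyCentral.le_cuspidalKernel s hd)

end CurveModel

end Literature.AnabelianGeometry.AbsoluteAnabelian.AbsTopIII
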